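import Summits.BirchSwinnertonDyer.BirchSwinnertonDyer.Theses.BiquadraticEisensteinDescent
import Summits.BirchSwinnertonDyer.BirchSwinnertonDyer.Theorems.BiquadraticEisensteinDescentDisjointDivisibilityDefs
import Literature.NumberTheory.EllipticCurves.HeegnerPointsImaginaryQuadraticProofs
import Literature.NumberTheory.QuadraticFields.DedekindZetaReducedForms
import Literature.NumberTheory.QuadraticFields.ClassNumberLeAbs
import Mathlib.Analysis.SpecialFunctions.Log.Basic
import HarnessLib

set_option linter.dupNamespace false -- `Summit.BirchSwinnertonDyer.BirchSwinnertonDyer.Theorems.…` (summit = sub)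
set_option autoImplicit false

/-!
# Route `BiquadraticEisensteinDescent`, crux `HeegnerTwistCouplingInSupply` (stmt-BirchSwinnertonDyer-21381) —
# the crux idea `disjoint-divisibility-pigeonhole`: glue as kernel theorems, and the DOOR to the route decl

Cell `pub/bsd-wall`, width-prover seat `bsd-wall-cm-bed-w4` g24 (explicit-unit, `--supports stmt-BirchSwinnertonDyer-21381`
as helper). Objects: `Theorems/BiquadraticEisensteinDescentDisjointDivisibilityDefs.lean` (the card's sketch
`Cruxes/HeegnerTwistCouplingInSupply/SketchIdeasSeatOneG24.lean`, verbatim, + the typed inputs S3 = `HeegnerSplitDensity` and the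
corrected headline `AlmostAllPrimesShape`). Card: `Cruxes/HeegnerTwistCouplingInSupply/Ideas/disjoint-divisibility-pigeonhole.md`
(cruxidea seat 1 g24, 2026-08-29).

What is PROVED here (standard axioms; every research-grade input is an explicit hypothesis, nothing is asserted about it):

* §1 `primesDividingInBlock_card_le`, `blockDoubleCount` — the card's elementary disjointness lemmas (S2), reproved verbatim
  from the sketch (not importable from `Theorems`); `natLog_le_log_div_log` (`⌊log_P Y⌋ ≤ log Y/log P`).
* §2 the bookkeeping that makes the double count over `p` legitimate: `classNumber_eq_formClassNumber` (**`h_K = h(d_K)`**,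
  Cox Thm. 7.7(ii) = tree `Quadratic.card_reducedForms_eq_classNumber`) — `h` is a function of the discriminant;
  `isDivisibleDisc_iff_dvd_classNumber`; `h(d) ≥ 1` and **`h(d) ≤ |d|`** on Heegner discriminants (tree
  `BinaryQuadraticForm.classNumber_le_natAbs`, Lenstra–Pomerance (2.3)); the **level inclusion**
  `ambient_subset_of_dvd : M ∣ N → A_N(Y) ⊆ A_M(Y)` («Heegner for `N₀p²` ⇒ Heegner for `N₀`»).
* §3 **`pigeonholeTransfer : ∀ A B, pigeonholeTransferShape A B`** — the card's declared FIRST STUB, proved for all `A, B`.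
* §4 **`card_popular_le`** — the card's second stub (exceptional set), CORRECTED by the hypothesis `A_{N₀}(Y) ≠ ∅` (the
  sketch's hypothesis-free `exceptionalSetShape` is false: on an empty ambient set every prime is vacuously popular —
  refuted by value in the companion file `…DisjointDivisibilityExtras.lean`): the `τ`-popular primes of a block `[P, 2P]`
  number `≤ ⌊log_P Y⌋/τ ≤ (log Y/log P + 1)/τ` (`card_popular_le_log`).
* §5 `exists_isCouplingDisc_of_not_popular` — the card's «Transfer» per `(W, p)`;
  **`almostAllPrimes_of_inputs : 0 < c → S1(A,B) → S3(A,c) → AlmostAllPrimesShape A B c`** — the headline theorem-shape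
  (all but `≤ c·(log Y/log P)·(log Y)^B` primes `p ∈ [P, 2P]`, `Y = (N₀(2P)²)^A`; the exceptional set = the popular primes).
* §6 **`heegnerTwistCouplingInSupply_of_levelUniform_of_thin`** — DOOR to the route decl `HeegnerTwistCouplingInSupply` BY NAME
  from S1 and the card's h-side residual in its sharpest block-free form («at `Y = N_W^A` fewer than a `(log Y)^{-B}`-fraction
  of `A_{N_W}(Y)` is `p`-divisible» — thin upper density, Cohen–Lenstra class, open for every individual `p ≥ 5`);
  `cruxConclusion_of_inputs_of_not_mem` — the block form (crux conclusion at `(W, p)` for non-exceptional `p`, from S1 ∧ S3).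

HONEST SCOPE: glue and reductions only. S1 = `LevelUniformNonvanishingCount` (level-uniform effective non-vanishing count) is
NOT in print in this uniformity; S3 = `HeegnerSplitDensity` is elementary (squarefree counting in progressions) but not in the
tree; the residual for the GIVEN `p` is of Cohen–Lenstra type. The crux, `C⁺` and BSD are NOT proved; stmt-21381 is NOT closed;
the door credits nothing (closure modulo unregistered hypotheses).

References: D. A. Cox, *Primes of the form x² + ny²*, 2nd ed., Thm. 7.7(ii) [Cox2013]; H. W. Lenstra Jr., C. Pomerance,
J. Amer. Math. Soc. 5 (1992), (2.3) [LenstraPomerance1992]; the card and sketch above.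
-/

noncomputable section

open scoped Classical

open Literature.NumberTheory.EllipticCurves Literature.NumberTheory.QuadraticFields

namespace Summit.BirchSwinnertonDyer.BirchSwinnertonDyer.Theorems.DisjointDivisibility

/-! ## §1. Elementary disjointness (S2) — the sketch's two counting lemmas, reproved verbatim -/

/-- A positive integer `h` has at most `log_P h` prime divisors in the block `[P, 2P]` (indeed at most `log_P h` prime
divisors `≥ P`): their product divides `h` and is `≥ P^{#}`. The sketch's `primesDividingInBlock_card_le` (card author's proof,
verbatim). [folklore] -/
theorem primesDividingInBlock_card_le (P h : ℕ) (hP : 2 ≤ P) (hh : 0 < h) :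
    ((Finset.Icc P (2 * P)).filter (fun q => q.Prime ∧ q ∣ h)).card ≤ Nat.log P h := by
  set S := (Finset.Icc P (2 * P)).filter (fun q => q.Prime ∧ q ∣ h) with hS
  have hprime : ∀ q ∈ S, Prime q := by
    intro q hq
    simp only [hS, Finset.mem_filter] at hq
    exact Nat.prime_iff.mp hq.2.1
  have hdvd : ∀ q ∈ S, q ∣ h := by
    intro q hq
    simp only [hS, Finset.mem_filter] at hq
    exact hq.2.2
  have hge : ∀ q ∈ S, P ≤ q := by
    intro q hq
    simp only [hS, Finset.mem_filter, Finset.mem_Icc] at hq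
    exact hq.1.1
  have hprod_dvd : (∏ q ∈ S, q) ∣ h := Finset.prod_primes_dvd h hprime hdvd
  have hprod_le : (∏ q ∈ S, q) ≤ h := Nat.le_of_dvd hh hprod_dvd
  have hpow_le : P ^ S.card ≤ ∏ q ∈ S, q := Finset.pow_card_le_prod S (fun q => q) P hge
  have hP1 : 1 < P := by omega
  exact Nat.le_log_of_pow_le hP1 (le_trans hpow_le hprod_le)

/-- Double counting over a dyadic block: if every `d ∈ A` carries a positive "class number" `hf d` with
`log_P (hf d) ≤ L`, then `∑_{P ≤ q ≤ 2P prime} #{d ∈ A : q ∣ hf d} ≤ L · #A`. The sketch's `blockDoubleCount` (card author's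
proof, verbatim). [folklore] -/
theorem blockDoubleCount (A : Finset ℤ) (hf : ℤ → ℕ) (P L : ℕ) (hP : 2 ≤ P)
    (hpos : ∀ d ∈ A, 0 < hf d) (hlog : ∀ d ∈ A, Nat.log P (hf d) ≤ L) :
    ∑ q ∈ (Finset.Icc P (2 * P)).filter Nat.Prime, (A.filter (fun d => q ∣ hf d)).card
      ≤ L * A.card := by
  have key : ∀ q ∈ (Finset.Icc P (2 * P)).filter Nat.Prime,
      (A.filter (fun d => q ∣ hf d)).card = ∑ d ∈ A, if q ∣ hf d then 1 else 0 := by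
    intro q _
    rw [Finset.card_filter]
  rw [Finset.sum_congr rfl key, Finset.sum_comm]
  have bound : ∀ d ∈ A,
      (∑ q ∈ (Finset.Icc P (2 * P)).filter Nat.Prime, if q ∣ hf d then 1 else 0) ≤ L := by
    intro d hd
    rw [← Finset.card_filter]
    have : ((Finset.Icc P (2 * P)).filter Nat.Prime).filter (fun q => q ∣ hf d)
        = (Finset.Icc P (2 * P)).filter (fun q => q.Prime ∧ q ∣ hf d) := by
      rw [Finset.filter_filter]
    rw [this]
    exact le_trans (primesDividingInBlock_card_le P (hf d) hP (hpos d hd)) (hlog d hd)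
  calc ∑ d ∈ A, ∑ q ∈ (Finset.Icc P (2 * P)).filter Nat.Prime, (if q ∣ hf d then 1 else 0)
      ≤ ∑ d ∈ A, L := Finset.sum_le_sum bound
    _ = L * A.card := by rw [Finset.sum_const, smul_eq_mul, mul_comm]

/-- `⌊log_P Y⌋ ≤ log Y / log P` in `ℝ` for `P ≥ 2` (from `P^{⌊log_P Y⌋} ≤ Y`). [folklore] -/
theorem natLog_le_log_div_log {P Y : ℕ} (hP : 2 ≤ P) (hY : Y ≠ 0) :
    (Nat.log P Y : ℝ) ≤ Real.log Y / Real.log P := by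
  have hPpos : (0 : ℝ) < P := by exact_mod_cast (by omega : 0 < P)
  have hlogP : 0 < Real.log P := Real.log_pos (by exact_mod_cast (by omega : 1 < P))
  have hpow : ((P : ℝ)) ^ Nat.log P Y ≤ (Y : ℝ) := by exact_mod_cast Nat.pow_log_le_self P hY
  have h1 : (Nat.log P Y : ℝ) * Real.log P ≤ Real.log Y := by
    rw [← Real.log_pow]
    exact Real.log_le_log (pow_pos hPpos _) hpow
  rwa [le_div_iff₀ hlogP]

/-! ## §2. Bookkeeping: `h(d_K) = h_K`, the divisibility predicate, the ambient set -/

/-- **`h_K = h(d_K)`**: the class number of an imaginary quadratic field `K` is the form class number of its discriminant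
(Cox Thm. 7.7(ii), the tree's `Quadratic.card_reducedForms_eq_classNumber`) — so `h` is a function of the DISCRIMINANT, which
is what makes the card's double count over `p` legitimate. [cite: Cox2013, §7.B Thm. 7.7(ii)] -/
theorem classNumber_eq_formClassNumber {K : Type} [Field K] [NumberField K] (hK : IsImaginaryQuadratic K) :
    NumberField.classNumber K = BinaryQuadraticForm.classNumber (NumberField.discr K) :=
  (Quadratic.card_reducedForms_eq_classNumber hK.1 hK.discr_neg).symm

/-- `IsDivisibleDisc p d ⇒ p ∣ h(d)` (form class number). [folklore] -/
theorem dvd_formClassNumber_of_isDivisibleDisc {p : ℕ} {d : ℤ} (h : IsDivisibleDisc p d) :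
    p ∣ BinaryQuadraticForm.classNumber d := by
  obtain ⟨K, _, _, hK, hd, hp⟩ := h
  rw [← hd, ← classNumber_eq_formClassNumber hK]
  exact hp

/-- Conversely, at a fundamental discriminant `d = d_K`: `p ∣ h(d) ⇒ IsDivisibleDisc p d`. [folklore] -/
theorem isDivisibleDisc_of_dvd_formClassNumber {p : ℕ} {d : ℤ} {K : Type} [hF : Field K] [hNF : NumberField K]
    (hK : IsImaginaryQuadratic K) (hd : NumberField.discr K = d) (hp : p ∣ BinaryQuadraticForm.classNumber d) :
    IsDivisibleDisc p d := by
  have hp' : p ∣ NumberField.classNumber K := by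
    rw [classNumber_eq_formClassNumber hK, hd]
    exact hp
  exact ⟨K, hF, hNF, hK, hd, hp'⟩

/-- `IsDivisibleDisc p d_K ↔ p ∣ h_K` for an imaginary quadratic field `K` (any two imaginary quadratic fields with the same
discriminant have the same class number, via `h_K = h(d_K)`). [folklore] -/
theorem isDivisibleDisc_iff_dvd_classNumber {p : ℕ} {K : Type} [hF : Field K] [hNF : NumberField K]
    (hK : IsImaginaryQuadratic K) :
    IsDivisibleDisc p (NumberField.discr K) ↔ p ∣ NumberField.classNumber K := by
  refine ⟨fun h => ?_, fun h => ⟨K, hF, hNF, hK, rfl, h⟩⟩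
  rw [classNumber_eq_formClassNumber hK]
  exact dvd_formClassNumber_of_isDivisibleDisc h

/-- `h(d) ≥ 1` at a Heegner discriminant (it is the class number of a field). [folklore] -/
theorem formClassNumber_pos_of_isHeegnerDisc {N : ℕ} {d : ℤ} (h : IsHeegnerDisc N d) :
    0 < BinaryQuadraticForm.classNumber d := by
  obtain ⟨K, _, _, hK, hd, -, -⟩ := h
  rw [← hd, ← classNumber_eq_formClassNumber hK]
  exact NumberField.classNumber_pos K

/-- `h(d) ≤ |d|` at a Heegner discriminant (the tree's crude bound `BinaryQuadraticForm.classNumber_le_natAbs`,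
Lenstra–Pomerance (2.3); Oesterlé's `π⁻¹√|d| log|d|` is not needed). [cite: LenstraPomerance1992, §2 (2.3)] -/
theorem formClassNumber_le_natAbs_of_isHeegnerDisc {N : ℕ} {d : ℤ} (h : IsHeegnerDisc N d) :
    BinaryQuadraticForm.classNumber d ≤ d.natAbs := by
  obtain ⟨K, _, _, hK, hd, -, -⟩ := h
  have hneg : d < 0 := hd ▸ hK.discr_neg
  exact BinaryQuadraticForm.classNumber_le_natAbs hneg

/-- The Heegner-discriminant predicate is inherited by divisors of the level (`SatisfiesHeegnerHypothesis.of_dvd`).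
[folklore] -/
theorem IsHeegnerDisc.of_dvd {M N : ℕ} {d : ℤ} (hMN : M ∣ N) (h : IsHeegnerDisc N d) : IsHeegnerDisc M d := by
  obtain ⟨K, hF, hNF, hK, hd, h4, hH⟩ := h
  exact ⟨K, hF, hNF, hK, hd, h4, hH.of_dvd hMN⟩

/-- Membership in the ambient set `A_N(Y)`. [folklore] -/
theorem mem_ambient {N Y : ℕ} {d : ℤ} :
    d ∈ ambient N Y ↔ (-(Y : ℤ) ≤ d ∧ d ≤ -5) ∧ IsHeegnerDisc N d := by
  simp only [ambient, Finset.mem_filter, Finset.mem_Icc]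

/-- `|d| ≤ Y` on `A_N(Y)`. [folklore] -/
theorem natAbs_le_of_mem_ambient {N Y : ℕ} {d : ℤ} (h : d ∈ ambient N Y) : d.natAbs ≤ Y := by
  have h' := (mem_ambient.1 h).1
  omega

/-- A non-empty ambient set forces `Y ≥ 5`. [folklore] -/
theorem five_le_of_ambient_nonempty {N Y : ℕ} (h : (ambient N Y).Nonempty) : 5 ≤ Y := by
  obtain ⟨d, hd⟩ := h
  have h' := (mem_ambient.1 hd).1
  omega

/-- **Level inclusion** `A_N(Y) ⊆ A_M(Y)` for `M ∣ N` — in the card, `A_{N₀p²}(Y) ⊆ A₀(Y) = A_{N₀}(Y)`: «Heegner for `N₀p²`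
is Heegner for `N₀` plus the condition at `p`». [folklore] -/
theorem ambient_subset_of_dvd {M N Y : ℕ} (hMN : M ∣ N) : ambient N Y ⊆ ambient M Y := by
  intro d hd
  rw [mem_ambient] at hd ⊢
  exact ⟨hd.1, hd.2.of_dvd hMN⟩

/-- `S_p ∩ A_N(Y) ⊆ {d ∈ A_N(Y) : p ∣ h(d)}` (in fact equality; only this inclusion is used). [folklore] -/
theorem divisibleIn_subset_filter_dvd (N Y p : ℕ) :
    divisibleIn N Y p ⊆ (ambient N Y).filter (fun d => p ∣ BinaryQuadraticForm.classNumber d) := by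
  intro d hd
  rw [divisibleIn, Finset.mem_filter] at hd
  exact Finset.mem_filter.2 ⟨hd.1, dvd_formClassNumber_of_isDivisibleDisc hd.2⟩

/-! ## §3. The card's FIRST STUB: the pigeonhole transfer, for every `A, B` -/

/-- **The pigeonhole transfer (the card's declared first stub `pigeonholeTransferShape A B`), PROVED for all `A, B`.**
From S1 at a height `Y ≥ N_W^A`: `#nonvanishingIn W N_W Y ≥ #A_{N_W}(Y)/(log Y)^B > #divisibleIn N₀ Y p`; since
`nonvanishingIn ⊆ A_{N_W}(Y) ⊆ A_{N₀}(Y)`, some non-vanishing `d` is not `p`-divisible, and `¬ IsDivisibleDisc p d` at the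
fundamental discriminant `d = d_K` is `p ∤ h_K` — the crux conclusion at `d`. [folklore] -/
theorem pigeonholeTransfer (A B : ℕ) : pigeonholeTransferShape A B := by
  intro hS1 W _ _ _ p N₀ Y hCM hr hY hsub hlt
  have h1 := hS1 W hCM hr Y hY
  have hlt' : ((divisibleIn N₀ Y p).card : ℝ) <
      ((nonvanishingIn W (W.conductorNorm ℤ) Y).card : ℝ) := hlt.trans_le h1
  have hlt'' : (divisibleIn N₀ Y p).card < (nonvanishingIn W (W.conductorNorm ℤ) Y).card := by
    exact_mod_cast hlt'
  obtain ⟨d, hdnv, hdndiv⟩ := Finset.exists_mem_notMem_of_card_lt_card hlt''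
  rw [nonvanishingIn, Finset.mem_filter] at hdnv
  obtain ⟨hdamb, hL⟩ := hdnv
  have hndiv : ¬ IsDivisibleDisc p d := fun h =>
    hdndiv (by rw [divisibleIn, Finset.mem_filter]; exact ⟨hsub d hdamb, h⟩)
  obtain ⟨K, hF, hNF, hK, hd, h4, hH⟩ := (mem_ambient.1 hdamb).2
  exact ⟨d, K, hF, hNF, hK, hd, h4, hH, hL, fun hp => hndiv ⟨K, hF, hNF, hK, hd, hp⟩⟩

/-! ## §4. The exceptional set: at most `⌊log_P Y⌋/τ` popular primes per dyadic block (S2 ⇒), corrected statement -/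

/-- **Exceptional-set count (the card's second stub, CORRECTED by the hypothesis `A_{N₀}(Y) ≠ ∅`).** For a twist-core
level `N₀`, a height `Y` with a non-empty ambient Heegner set, a block `[P, 2P]` (`P ≥ 2`) and `τ > 0`, the number of
`τ`-popular primes in the block is at most `⌊log_P Y⌋ / τ`: summing `τ·#A₀ ≤ #(S_p ∩ A₀)` over the popular primes and
bounding the full block sum by `blockDoubleCount` with `hf d = h(d) ≤ |d| ≤ Y`. [folklore] -/
theorem card_popular_le {N₀ Y P : ℕ} {τ : ℝ} (hP : 2 ≤ P) (hτ : 0 < τ) (hA : (ambient N₀ Y).Nonempty) :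
    ((((Finset.Icc P (2 * P)).filter Nat.Prime).filter (fun p => Popular N₀ Y p τ)).card : ℝ)
      ≤ (Nat.log P Y : ℝ) / τ := by
  set A₀ := ambient N₀ Y with hA₀
  set Pr := (Finset.Icc P (2 * P)).filter Nat.Prime with hPr
  set Pop := Pr.filter (fun p => Popular N₀ Y p τ) with hPop
  have hApos : (0 : ℝ) < A₀.card := by exact_mod_cast hA.card_pos
  have h1 : ∀ p ∈ Pop, τ * (A₀.card : ℝ) ≤
      ((A₀.filter (fun d => p ∣ BinaryQuadraticForm.classNumber d)).card : ℝ) := by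
    intro p hp
    have hpop : Popular N₀ Y p τ := (Finset.mem_filter.1 hp).2
    refine hpop.trans ?_
    exact_mod_cast Finset.card_le_card (divisibleIn_subset_filter_dvd N₀ Y p)
  have h2 : ∑ p ∈ Pr, (A₀.filter (fun d => p ∣ BinaryQuadraticForm.classNumber d)).card
      ≤ Nat.log P Y * A₀.card :=
    blockDoubleCount A₀ (fun d => BinaryQuadraticForm.classNumber d) P (Nat.log P Y) hP
      (fun d hd => formClassNumber_pos_of_isHeegnerDisc (mem_ambient.1 hd).2)
      (fun d hd => Nat.log_mono_right
        ((formClassNumber_le_natAbs_of_isHeegnerDisc (mem_ambient.1 hd).2).trans (natAbs_le_of_mem_ambient hd)))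
  have h3 : (Pop.card : ℝ) * τ * A₀.card ≤ (Nat.log P Y : ℝ) * A₀.card := by
    calc (Pop.card : ℝ) * τ * A₀.card = ∑ p ∈ Pop, τ * (A₀.card : ℝ) := by
          rw [Finset.sum_const, nsmul_eq_mul, mul_assoc]
      _ ≤ ∑ p ∈ Pop, ((A₀.filter (fun d => p ∣ BinaryQuadraticForm.classNumber d)).card : ℝ) :=
          Finset.sum_le_sum h1
      _ ≤ ∑ p ∈ Pr, ((A₀.filter (fun d => p ∣ BinaryQuadraticForm.classNumber d)).card : ℝ) :=
          Finset.sum_le_sum_of_subset_of_nonneg (Finset.filter_subset _ _) (fun _ _ _ => by positivity)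
      _ ≤ (Nat.log P Y : ℝ) * A₀.card := by exact_mod_cast h2
  have h4 : (Pop.card : ℝ) * τ ≤ Nat.log P Y := le_of_mul_le_mul_right h3 hApos
  rwa [le_div_iff₀ hτ]

/-- The same with the card's real-logarithm bound `(log Y / log P + 1)/τ` (indeed `≤ (log Y/log P)/τ`), under the one
hypothesis the sketch's `exceptionalSetShape` omits: `A_{N₀}(Y) ≠ ∅`. [folklore] -/
theorem card_popular_le_log {N₀ Y P : ℕ} {τ : ℝ} (hP : 2 ≤ P) (hτ : 0 < τ) (hA : (ambient N₀ Y).Nonempty) :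
    ((((Finset.Icc P (2 * P)).filter Nat.Prime).filter (fun p => Popular N₀ Y p τ)).card : ℝ)
      ≤ (Real.log Y / Real.log P + 1) / τ := by
  have hY : Y ≠ 0 := by have := five_le_of_ambient_nonempty hA; omega
  refine (card_popular_le hP hτ hA).trans ?_
  refine div_le_div_of_nonneg_right ?_ hτ.le
  linarith [natLog_le_log_div_log hP hY]

/-! ## §5. The card's «Transfer», kernel form: crux(W, p) ⟸ S1 ∧ S3-at-(N₀,p,Y) ∧ ¬Popular; and the headline
## almost-all-`p` shape ⟸ S1 ∧ S3 -/

/-- **The card's «Transfer» paragraph as a theorem, per `(W, p)`.** For a CM curve `W` of analytic rank one and conductor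
`N₀p²`, a height `Y ≥ (N₀p²)^A`, the S3 inequality `#A₀(Y) ≤ c·#A_{N₀p²}(Y)` at this `(N₀, p, Y)` and NON-popularity of `p`
at threshold `τ = 1/(c (log Y)^B)`, S1 gives a coupling discriminant (pigeonhole inside `A_{N₀p²}(Y) ⊆ A₀(Y)`). The two
research-grade inputs (S1; `¬ Popular` for the GIVEN `p`, Cohen–Lenstra class) are hypotheses; nothing is claimed about them.
[folklore] -/
theorem exists_isCouplingDisc_of_not_popular {A B : ℕ} {c : ℝ} (hc : 0 < c)
    (hS1 : LevelUniformNonvanishingCount A B)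
    (W : WeierstrassCurve ℚ) [W.IsElliptic] [W.IsGloballyMinimal] [NeZero (W.conductorNorm ℤ)]
    (p N₀ Y : ℕ) (hCM : W.HasCM) (hr : W.analyticRank = 1) (hN : W.conductorNorm ℤ = N₀ * p ^ 2)
    (hY : (N₀ * p ^ 2) ^ A ≤ Y)
    (hS3 : ((ambient N₀ Y).card : ℝ) ≤ c * ((ambient (N₀ * p ^ 2) Y).card : ℝ))
    (hnp : ¬ Popular N₀ Y p (1 / (c * (Real.log Y) ^ B))) :
    ∃ d : ℤ, IsCouplingDisc W p d := by
  refine pigeonholeTransfer A B hS1 W p N₀ Y hCM hr (by rw [hN]; exact hY)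
    (fun d hd => ambient_subset_of_dvd (Dvd.intro (p ^ 2) hN.symm) hd) ?_
  rw [Popular, not_le] at hnp
  rw [hN]
  refine hnp.trans_le ?_
  have hLB : 0 ≤ (Real.log Y) ^ B := pow_nonneg (Real.log_natCast_nonneg Y) B
  have hA' : ((ambient N₀ Y).card : ℝ) / c ≤ ((ambient (N₀ * p ^ 2) Y).card : ℝ) := by
    rw [div_le_iff₀ hc, mul_comm]
    exact hS3
  calc 1 / (c * (Real.log Y) ^ B) * ((ambient N₀ Y).card : ℝ)
      = (((ambient N₀ Y).card : ℝ) / c) / (Real.log Y) ^ B := by ring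
    _ ≤ ((ambient (N₀ * p ^ 2) Y).card : ℝ) / (Real.log Y) ^ B :=
        div_le_div_of_nonneg_right hA' hLB

/-- **The card's headline theorem-shape from its two inputs: `S1(A, B) ∧ S3(A, c) ⇒ AlmostAllPrimesShape A B c`.** The
exceptional set is the set of `τ`-popular primes of the block at `Y = (N₀(2P)²)^A`, `τ = 1/(c (log Y)^B)`; its size is
`≤ ⌊log_P Y⌋/τ ≤ c·(log Y/log P)·(log Y)^B` by `card_popular_le`; off it, `exists_isCouplingDisc_of_not_popular` applies to
every CM curve of analytic rank one and conductor `N₀p²`, `P ≤ p ≤ 2P` (`(N₀p²)^A ≤ Y`, S3 at `(N₀, p, Y)`). Both inputs are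
hypotheses (S1 is NOT in print level-uniformly; S3 is elementary but not in the tree); the residual of the ∀-crux — `¬ Popular`
for the GIVEN `p` — is untouched. BSD is not proved by this; stmt-21381 is not closed. [folklore] -/
theorem almostAllPrimes_of_inputs (A B : ℕ) {c : ℝ} (hc : 0 < c)
    (hS1 : LevelUniformNonvanishingCount A B) (hS3 : HeegnerSplitDensity A c) :
    AlmostAllPrimesShape A B c := by
  intro N₀ P hP hN₀ hne
  set Y : ℕ := (N₀ * (2 * P) ^ 2) ^ A with hYdef
  set τ : ℝ := 1 / (c * (Real.log Y) ^ B) with hτdef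
  have hY5 : 5 ≤ Y := five_le_of_ambient_nonempty hne
  have hlogY : 0 < Real.log Y := Real.log_pos (by exact_mod_cast (by omega : 1 < Y))
  have hlogP : 0 < Real.log P := Real.log_pos (by exact_mod_cast (by omega : 1 < P))
  have hτ : 0 < τ := by rw [hτdef]; positivity
  refine ⟨((Finset.Icc P (2 * P)).filter Nat.Prime).filter (fun p => Popular N₀ Y p τ), ?_, ?_⟩
  · calc ((((Finset.Icc P (2 * P)).filter Nat.Prime).filter (fun p => Popular N₀ Y p τ)).card : ℝ)
        ≤ (Nat.log P Y : ℝ) / τ := card_popular_le hP hτ hne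
      _ ≤ (Real.log Y / Real.log P) / τ :=
          div_le_div_of_nonneg_right (natLog_le_log_div_log hP (by omega)) hτ.le
      _ = c * (Real.log Y / Real.log P) * (Real.log Y) ^ B := by
          rw [hτdef]
          field_simp
  · intro W _ _ _ p _ hCM hr hPp hp2P hpE hN
    have hp : p.Prime := Fact.out
    have hpPr : p ∈ (Finset.Icc P (2 * P)).filter Nat.Prime :=
      Finset.mem_filter.2 ⟨Finset.mem_Icc.2 ⟨hPp, hp2P⟩, hp⟩
    have hnp : ¬ Popular N₀ Y p τ := fun h => hpE (Finset.mem_filter.2 ⟨hpPr, h⟩)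
    have hY' : (N₀ * p ^ 2) ^ A ≤ Y :=
      Nat.pow_le_pow_left (Nat.mul_le_mul_left _ (Nat.pow_le_pow_left hp2P 2)) A
    exact exists_isCouplingDisc_of_not_popular hc hS1 W p N₀ Y hCM hr hN hY' (hS3 N₀ p Y hp hN₀ hY') hnp

/-! ## §6. DOOR to the route decl BY NAME: crux ⟸ S1 ∧ the thin `p`-divisibility residual inside `A_{N_W}(N_W^A)` -/

/-- **Door (kernel) from the card to the crux `HeegnerTwistCouplingInSupply` (stmt-BirchSwinnertonDyer-21381), BY NAME.**
The crux follows from S1 = `LevelUniformNonvanishingCount A B` together with the card's declared h-side residual in its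
sharpest, block-free form: for the GIVEN `(W, p)`, at the height `Y = N_W^A`, fewer than a `(log Y)^{-B}`-fraction of the
Heegner discriminants for `N_W` below `Y` have `p ∣ h(d)` (a THIN upper-density statement of Cohen–Lenstra class — truth
`≈ 1/p`; open for every individual `p ≥ 5`). Proof: `pigeonholeTransfer` with `N₀ = N_W`. The crux's own `∀ B`-supply
hypothesis is not used. Both inputs are hypotheses; BSD is not proved by this and stmt-21381 is NOT closed. [folklore] -/
theorem heegnerTwistCouplingInSupply_of_levelUniform_of_thin (A B : ℕ)
    (hS1 : LevelUniformNonvanishingCount A B)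
    (hthin : ∀ (W : WeierstrassCurve ℚ) [W.IsElliptic] [W.IsGloballyMinimal] (p : ℕ) [Fact p.Prime]
      [NeZero (W.conductorNorm ℤ)], W.HasCM → W.analyticRank = 1 → 5 ≤ p →
      Literature.NumberTheory.EllipticCurves.Rank1Residual.CMInert W p →
      ¬ Literature.NumberTheory.EllipticCurves.Rank1Residual.Good W p →
      ((divisibleIn (W.conductorNorm ℤ) ((W.conductorNorm ℤ) ^ A) p).card : ℝ) <
        ((ambient (W.conductorNorm ℤ) ((W.conductorNorm ℤ) ^ A)).card : ℝ) /
          (Real.log (((W.conductorNorm ℤ) ^ A : ℕ) : ℝ)) ^ B) :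
    Summit.BirchSwinnertonDyer.BirchSwinnertonDyer.Theses.BiquadraticEisensteinDescent.HeegnerTwistCouplingInSupply := by
  intro W _ _ p _ _ hCM hr hp5 hin hbad _
  obtain ⟨d, K, hF, hNF, hK, hd, h4, hH, hL, hndvd⟩ :=
    pigeonholeTransfer A B hS1 W p (W.conductorNorm ℤ) ((W.conductorNorm ℤ) ^ A) hCM hr le_rfl
      (fun _ hd => hd) (hthin W p hCM hr hp5 hin hbad)
  subst hd
  exact ⟨K, hF, hNF, hK, h4, hH, hL, hndvd⟩

/-- **Door, block form (the card's headline made to bear on the crux for the non-exceptional primes).** Under S1 and S3, for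
a twist-core level `N₀ > 0` and a block `[P, 2P]` with non-empty ambient set at `Y = (N₀(2P)²)^A`, every `(W, p)` of the
crux's corner with `N_W = N₀p²`, `P ≤ p ≤ 2P` and `p` outside the exceptional set of `almostAllPrimes_of_inputs` (of size
`≤ c·(log Y/log P)·(log Y)^B`) satisfies the crux's conclusion — stated as the conclusion of the route decl at `(W, p)`.
[folklore] -/
theorem cruxConclusion_of_inputs_of_not_mem (A B : ℕ) {c : ℝ} (hc : 0 < c)
    (hS1 : LevelUniformNonvanishingCount A B) (hS3 : HeegnerSplitDensity A c)
    (N₀ P : ℕ) (hP : 2 ≤ P) (hN₀ : 0 < N₀) (hne : (ambient N₀ ((N₀ * (2 * P) ^ 2) ^ A)).Nonempty) :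
    ∃ E : Finset ℕ,
      (E.card : ℝ) ≤ c * (Real.log ((N₀ * (2 * P) ^ 2) ^ A : ℕ) / Real.log P) *
          (Real.log ((N₀ * (2 * P) ^ 2) ^ A : ℕ)) ^ B ∧
      ∀ (W : WeierstrassCurve ℚ) [W.IsElliptic] [W.IsGloballyMinimal] (p : ℕ) [Fact p.Prime]
        [NeZero (W.conductorNorm ℤ)], W.HasCM → W.analyticRank = 1 → P ≤ p → p ≤ 2 * P → p ∉ E →
        W.conductorNorm ℤ = N₀ * p ^ 2 →
        ∃ (K : Type) (_ : Field K) (_ : NumberField K), IsImaginaryQuadratic K ∧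
          4 < (NumberField.discr K).natAbs ∧ SatisfiesHeegnerHypothesis (W.conductorNorm ℤ) K ∧
          (W.quadraticTwist (NumberField.discr K : ℚ)).entireLFunction 1 ≠ 0 ∧ ¬ p ∣ NumberField.classNumber K := by
  obtain ⟨E, hE, hcrux⟩ := almostAllPrimes_of_inputs A B hc hS1 hS3 N₀ P hP hN₀ hne
  refine ⟨E, hE, ?_⟩
  intro W _ _ p _ _ hCM hr hPp hp2 hpE hN
  obtain ⟨d, K, hF, hNF, hK, hd, h4, hH, hL, hndvd⟩ := hcrux W p hCM hr hPp hp2 hpE hN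
  subst hd
  exact ⟨K, hF, hNF, hK, h4, hH, hL, hndvd⟩

end Summit.BirchSwinnertonDyer.BirchSwinnertonDyer.Theorems.DisjointDivisibility

end
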